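import Summits.CriticalPhenomena.PercolationContinuityZ3.Theorems.PercNearOneGluingAdditiveGluingAL5RestrictedAnchor
import HarnessLib

/-! # Crux `PercNearOneGluing.AdditiveGluing` (stmt-CriticalPhenomena-4576) — AL5 for every relay set admitting a peeling order

Support file (`--supports stmt-CriticalPhenomena-4576`; task png-dp-al5); no definitions, no named facts.  Notation of
`…AL5Layers.lean` / `…AL5Peel.lean` / `…AL5RestrictedAnchor.lean`: bystander `x`, glued block `w^S`, relay neighbours `T`,
`F(T') = T'.image (s(x,·))`, `Z = {x} ∪ S`, `R_{T'} = {ω | ∃ a ∈ T', s(x,a) ∈ ω}`,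
AL5(T'): `μ_{w^S}(R_{T'} ∩ {d↔b}) ≤ μ_{w^S}(R_{T'} ∩ {x↔b})`.

**Theorem (`al5_of_peelable`).**  Assume `τ_w(d) ≤ τ_w(a)` for all `a ∈ T` and that every `T' ⊆ T` with `3 ≤ T'.card` contains a
relay `a` which is PEELABLE relative to `T'`: either the pinned hypothesis `τ(d) ≤ τ(a)` holds in `pinW w F(T') {s(x,a)}` (`x–a`
glued, the other edges of `F(T')` deleted, block star real), or the restricted premise `μ(d ↮ Z, d↔b) ≤ μ(d ↮ Z, a↔b)` holds in
`pinW w F(T') ∅`.  Then AL5(T) — by strong induction on `T'` (`al5_peel` with `al5_peel_hyp` / `al5_restricted_core`; base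
`al5_of_card_le_two`).  This packages the one-relay reductions into a single certificate-checking statement for arbitrary `|T|`
(exact enumeration, task census: a peeling order exists in every sampled instance with `|T| = 3, 4`).
[cite: KozmaNitzan2024, Lemma 3(i) (pp. 6–7), Lemma 5 (p. 13)]
-/

namespace Summit.CriticalPhenomena.PercolationContinuityZ3.Theorems

open MeasureTheory Set
open Literature.Probability.LatticeModels (prodBernoulli)
open Literature.Probability.Percolation (BondConfig openConn openConnIn openGraph openEdgeCluster pinW localCylinder)

noncomputable section
open Classical

section AL5PeelInduction

open Filter Topology Literature.Probability.LatticeModels Literature.Probability.Percolation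

variable {n : ℕ}

/-- **AL5 for every block and every relay set with a peeling order** (see the module docstring): `x ∉ S ∪ T`, `S ∩ T = ∅`,
`d ∉ {x} ∪ S`, hypotheses `τ_w(d) ≤ τ_w(a)` on `T`, and every `T' ⊆ T` with `3 ≤ T'.card` has a peelable relay `a ∈ T'`,
`a ≠ d` (pinned hypothesis OR restricted premise, both in the weighting with the other edges of `F(T')` deleted).  Then AL5(T).
[cite: KozmaNitzan2024, Lemma 3(i) (pp. 6–7), Lemma 5 (p. 13)] -/
theorem al5_of_peelable (w : Sym2 (Fin n) → unitInterval) (S T : Finset (Fin n)) (x d b : Fin n)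
    (hS : ∀ y ∈ S, y ≠ x) (hxT : x ∉ T) (hST : Disjoint S T) (hdx : d ≠ x) (hdS : d ∉ S)
    (hle : ∀ a ∈ T, (prodBernoulli w).real (openConn d b) ≤ (prodBernoulli w).real (openConn a b))
    (hpeel : ∀ T' ⊆ T, 3 ≤ T'.card → ∃ a ∈ T', a ≠ d ∧
      ((prodBernoulli (pinW w (↑(T'.image (fun y => s(x, y))) : Set (Sym2 (Fin n)))
          ({s(x, a)} : Set (Sym2 (Fin n))))).real (openConn d b) ≤
        (prodBernoulli (pinW w (↑(T'.image (fun y => s(x, y))) : Set (Sym2 (Fin n)))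
          ({s(x, a)} : Set (Sym2 (Fin n))))).real (openConn a b) ∨
       (prodBernoulli (pinW w (↑(T'.image (fun y => s(x, y))) : Set (Sym2 (Fin n)))
          (↑(∅ : Finset (Sym2 (Fin n))) : Set (Sym2 (Fin n))))).real
          ({ω : BondConfig (Fin n) | ∀ z ∈ (↑(insert x S) : Set (Fin n)), ¬ (openGraph ω).Reachable d z} ∩
            openConn d b) ≤
        (prodBernoulli (pinW w (↑(T'.image (fun y => s(x, y))) : Set (Sym2 (Fin n)))
          (↑(∅ : Finset (Sym2 (Fin n))) : Set (Sym2 (Fin n))))).real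
          ({ω : BondConfig (Fin n) | ∀ z ∈ (↑(insert x S) : Set (Fin n)), ¬ (openGraph ω).Reachable d z} ∩
            openConn a b))) :
    (prodBernoulli (fun e : Sym2 (Fin n) => if e ∈ S.image (fun y => s(x, y)) then 1 else w e)).real
        ({ω : Set (Sym2 (Fin n)) | ∃ a ∈ T, s(x, a) ∈ ω} ∩ openConn d b) ≤
      (prodBernoulli (fun e : Sym2 (Fin n) => if e ∈ S.image (fun y => s(x, y)) then 1 else w e)).real
        ({ω : Set (Sym2 (Fin n)) | ∃ a ∈ T, s(x, a) ∈ ω} ∩ openConn x b) := by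
  -- strong induction over the subsets of `T`
  suffices key : ∀ (k : ℕ) (T' : Finset (Fin n)), T'.card = k → T' ⊆ T →
      (prodBernoulli (fun e : Sym2 (Fin n) => if e ∈ S.image (fun y => s(x, y)) then 1 else w e)).real
          ({ω : Set (Sym2 (Fin n)) | ∃ a ∈ T', s(x, a) ∈ ω} ∩ openConn d b) ≤
        (prodBernoulli (fun e : Sym2 (Fin n) => if e ∈ S.image (fun y => s(x, y)) then 1 else w e)).real
          ({ω : Set (Sym2 (Fin n)) | ∃ a ∈ T', s(x, a) ∈ ω} ∩ openConn x b) from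
    key T.card T rfl Finset.Subset.rfl
  intro k
  induction k using Nat.strong_induction_on with
  | _ k ih =>
    intro T' hcard hT'T
    have hxT' : x ∉ T' := fun h => hxT (hT'T h)
    have hST' : Disjoint S T' := Finset.disjoint_of_subset_right hT'T hST
    have hle' : ∀ a ∈ T', (prodBernoulli w).real (openConn d b) ≤ (prodBernoulli w).real (openConn a b) :=
      fun a ha => hle a (hT'T ha)
    by_cases hsmall : T'.card ≤ 2
    · exact al5_of_card_le_two w S T' x d b hS hxT' hST' hsmall hle'
    · have h3 : 3 ≤ T'.card := by omega
      obtain ⟨a, haT', hda, halt⟩ := hpeel T' hT'T h3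
      have hrest := ih (T'.erase a).card (by rw [Finset.card_erase_of_mem haT']; omega) (T'.erase a) rfl
        ((Finset.erase_subset a T').trans hT'T)
      refine al5_peel w S T' x d b a haT' hxT' hrest ?_
      rcases halt with hpin | hres
      · exact al5_peel_hyp w S T' x d b a hS hST' haT' (fun h => hxT' (h ▸ haT')) hpin
      · have key := al5_restricted_core w S T' x d b a hS hxT' hST' hdx hdS (Ne.symm hda) haT' {s(x, a)}
          (Finset.singleton_subset_iff.2 (Finset.mem_image_of_mem _ haT')) (Finset.mem_singleton_self _) hres
        rwa [Finset.coe_singleton] at key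

end AL5PeelInduction

end

end Summit.CriticalPhenomena.PercolationContinuityZ3.Theorems
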